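import Summits.HodgeConjecture.HodgeConjecture.Theorems.R90S6TypeTwoCayleyBlock              -- ★ B1 (this seat, p864341): `transpose_map_mul_antidiag_mul_apply`, `v_eq_of_mul_sq_eq`; brings ★ `SplitDictionary.rel_of_coe_eq_block`, `LocalConjDatum`, the bridge ★ `ValuedFieldValuativeRelBridge`
import Literature.NumberTheory.Rogawski1990.UnitStableOrbitalIntegralHSideValueTypeTwo          -- ★ GENERIC `exists_rescaled_cyclicFrame` (isotropic cyclic frame of a unitary 2×2); brings ★ `ncard_selfDualStable_congr` (frame transport), ★ `ncard_selfDualStable_antidiag_companion_eq_sum` (the type-(2) H-side lattice count)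
import Literature.NumberTheory.Automorphic.HermitianLatticeTreeTransitive                       -- ★ `isUnimodular₂_iff_exists_mem_glInt` (tree vertices ↔ the `glInt` set-builder); brings ★ `HermitianLatticeTreeDefs` (`latticeTree`, `latticeTreeIso`, `IsSelfDualLattice`)
import Literature.NumberTheory.Automorphic.HermitianLatticeTreeEulerRelation                    -- ★ `latticeTreeIso_apply_eq_self_iff` (`α_γ v = v ↔ γ·v = v`)
import HarnessLib

/-!
# R90 · S6 — row E1.3.5.2.6, CARD HF2 «H-SIDE TWIN OF THE TYPE-(2) FRAME»: the `{0,2}`-compression `t_H = (A Cρ; C A) ∈ U(1,1)` of the literal type-(2) element and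
# its FIXED SELF-DUAL VERTICES on the tree `X₂` — `F₀(t_H) = Σ_{k ≤ N} q^k` (`Theorems/R90S6TreeFixDataTypeTwoU2.lean`)

Cell `hodgecm-mathlib`, crux H413 (`stmt-HodgeConjecture-24833`), route of record `HCCMUnconditional`; programme R90-TF, section S6 (base `R90-C14`), seat R90-C14-p07 (g2);
S6 dealer R90-C14-plan (g2) CARD HF2 (2026-09-05T02:06:19Z) + census «=» AS CUT (02:14:19Z): FILE 1 = (HF2.1) the compression letter + (HF2.2) the fixed self-dual count in ★
H2-closed's set-builder (`R90S6HSideEllipticValueClosed` :102 letters); FILE 2 (`R90S6TreeFixDataTypeTwoU2Shells`) = the first shells `N₀ = N₁ = q^{N+1}`.  Consumer BY NAME =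
typ1 (g3)'s (E2) sheet (the type-(2) elliptic κ-identity; DATA binders `(F₀, N₀, N₁)` per H-class of ★ H2-NUMBERS `orbitalIntegral_coeff_toVector_xiHCoeff_eq_closed_two`).  Helper
lane `--supports stmt-HodgeConjecture-24833 --as helper`; THEOREMS ONLY (no definition, no instance, no notation, no named fact, no `sorry`); imports = ★ B1 + ★
`Rogawski1990.UnitStableOrbitalIntegralHSideValueTypeTwo` (for its GENERIC §1 frame lemma only — its CM-pinned §2 is not used) + ★ `HermitianLatticeTreeTransitive` + ★
`HermitianLatticeTreeEulerRelation` + HarnessLib.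

THE MATHEMATICS [Kottwitz1988, §2; Flicker1998UnitaryFL, §6 p. 97; Rogawski1990, §3.6 pp. 28–29, §4.9 Prop. 4.9.1 (b) p. 55; Serre1980Trees, II.1.1].  `K` non-dyadic valued
(`hd : LocalConjDatum σ ϖ`, residue field of order `q²`), `U₂ = U(σ, J₂)(K)`, `J₂ = antidiag(1,1)`, acting on the lattice tree `X₂ = latticeTree σ ϖ J₂` (self-dual and
`ϖ`-modular `𝒪_K`-lattices of `K²`; the Bruhat–Tits tree of `U(1,1)(F)`, `(q+1)`-regular).  The type-(2) literal `t = (A 0 Cρ; 0 u 0; C 0 A) ∈ U₃` (★ B1∕B2: `|ρ| = |ϖ|`,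
`|C| = |ϖ^N|`) has `H = U(1,1) × U(1)`-image `(t_H, u)`, `t_H = (A Cρ; C A)`: (§1, HF2.1) `t_H ∈ U₂` — the four corner relations of ★ `SplitDictionary.rel_of_coe_eq_block` ARE
the `antidiag(1,1)`-relations.  (§2) the fixed self-dual VERTICES of any `γ ∈ U₂` on `X₂` are counted by the `γ`-stable self-dual LATTICES `S(J₂, γ)` of ★
`SelfDualLatticeCountFrameTransport` (bridge ★ `isUnimodular₂_iff_exists_mem_glInt`, ★ `latticeTreeIso_apply_eq_self_iff`).  (§3, HF2.2) `t_H = A·1 + C·Π`, `Π = (0 ρ; 1 0)`,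
`Π² = ρ`: `χ_{t_H} = (X − A)² − C²ρ` has no root (`ρ` has odd valuation), `|tr² − 4det| = |4C²ρ| = |ϖ^{2N+1}|`, so by the ISOTROPIC CYCLIC FRAME (★ `exists_rescaled_cyclicFrame`,
rescaled by `ϖ^{−⌊N∕2⌋}`), ★ frame transport `ncard_selfDualStable_congr` and ★ THE TYPE-(2) H-SIDE LATTICE COUNT `ncard_selfDualStable_antidiag_companion_eq_sum`:
**`F₀(t_H) := #{x ∈ X₂ self-dual : t_H·x = x} = Σ_{k ≤ N} q^k`** — the self-dual half of the EDGE-CENTRED BALL of radius `N` about the edge `(L₀, ΠL₀)` (the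
`𝒪_{K(√ρ)}`-chain; ramified-torus type), over the engine's residual frame `(σO, a₀, #𝓀 = q²)` VERBATIM.  Hand check `N = 0`: `F₀ = 1` (`L₀` alone).
HONEST LABEL: the H-side DATA `F₀` of one type-(2) class, unconditional in its letters; the first shells `N₀, N₁` are FILE 2; count-neutral until typ1's (E2) consumes it.
HC_CM is proved only modulo the 7 printed citations (2 remaining named inputs: hLiu418 = stmt-HodgeConjecture-24832, h413 = stmt-HodgeConjecture-24833) until rung 0 closes.

## References
* [Kottwitz1988] R. E. Kottwitz, *Tamagawa numbers*, Ann. of Math. 127 (1988), §2 (fixed points of elliptic elements on the building).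
* [Flicker1998UnitaryFL] Y. Z. Flicker, *Elementary proof of the fundamental lemma for a unitary group*, Canad. J. Math. 50 (1998), §6 p. 95 Remark, p. 97.
* [Rogawski1990] J. D. Rogawski, *Automorphic Representations of Unitary Groups in Three Variables*, Ann. of Math. Stud. 123 (1990), §3.6 pp. 28–29, §4.9 Prop. 4.9.1 (b) p. 55.
* [Serre1980Trees] J.-P. Serre, *Trees* (1980), Ch. II §1.1 (lattices, the tree, balls).
-/
set_option autoImplicit false
-- the mandated namespace repeats the single-problem summit's segment (`HodgeConjecture.HodgeConjecture`)
set_option linter.dupNamespace false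

noncomputable section

open Matrix Finset ValuativeRel
open Literature.NumberTheory.Automorphic Literature.NumberTheory.Automorphic.UnitaryGroup Literature.NumberTheory.Automorphic.HermitianLatticeTree
open scoped Matrix MatrixGroups WithZero ValuativeRel

namespace Summit.HodgeConjecture.HodgeConjecture.R90.S6

/-! ### §1 (HF2.1) The `{0,2}`-compression of the literal frame lies in `U(1,1)` -/

section Compression

variable {K : Type*} [Field K] {σ : K →+* K}

/-- **(HF2.1) THE COMPRESSION LETTER**: if `t ∈ U(σ, J₃)(K)` has the `H = U(1,1) × U(1)`-pattern `(α 0 β; 0 e 0; γ 0 δ)`, then its `{0,2}`-corner `t_H = (α β; γ δ)` lies in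
`U(σ, J₂)(K)`, `J₂ = antidiag(1,1)` — the four corner relations of ★ `SplitDictionary.rel_of_coe_eq_block` are the entrywise unitarity of `t_H` (★ `mem_unitaryGroupOfForm_antidiagonal_iff_sum'`).
For the type-(2) literal `t = (A 0 Cρ; 0 u 0; C 0 A)`: `t_H = (A Cρ; C A) ∈ U₂`. [cite: Rogawski1990, §4.8 Case (a) p. 53; §4.9 p. 54] [cite: Flicker1998UnitaryFL, Prop. 6 p. 83] -/
theorem exists_unitaryTwo_coe_eq_corner {t : ↥(unitaryGroupOfForm σ ((StdForm.antidiagonal 3).over K))} {α β γ δ e : K}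
    (ht : ((t : GL (Fin 3) K) : Matrix (Fin 3) (Fin 3) K) = !![α, 0, β; 0, e, 0; γ, 0, δ]) :
    ∃ tH : ↥(unitaryGroupOfForm σ ((StdForm.antidiagonal 2).over K)), ((tH : GL (Fin 2) K) : Matrix (Fin 2) (Fin 2) K) = !![α, β; γ, δ] := by
  obtain ⟨⟨R1, R2, R3, R4⟩, -⟩ := SplitDictionary.rel_of_coe_eq_block σ t.2 ht
  have hΔ : α * δ - β * γ ≠ 0 := SplitDictionary.det_ne_zero σ R1 R2
  have hdet : (!![α, β; γ, δ] : Matrix (Fin 2) (Fin 2) K).det ≠ 0 := by rw [Matrix.det_fin_two_of]; exact hΔ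
  have r0 : Fin.rev (0 : Fin 2) = 1 := rfl
  have r1 : Fin.rev (1 : Fin 2) = 0 := rfl
  have hmem : Matrix.GeneralLinearGroup.mkOfDetNeZero _ hdet ∈ unitaryGroupOfForm σ ((StdForm.antidiagonal 2).over K) := by
    rw [mem_unitaryGroupOfForm_antidiagonal_iff_sum']
    intro a b
    fin_cases a <;> fin_cases b <;>
      simp [Matrix.GeneralLinearGroup.val_mkOfDetNeZero, Fin.sum_univ_two, r0, r1] <;>
      first | linear_combination R1 | linear_combination R2 | linear_combination R3 | linear_combination R4
  exact ⟨⟨_, hmem⟩, Matrix.GeneralLinearGroup.val_mkOfDetNeZero _ _⟩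

end Compression

/-! ### §2 Fixed self-dual vertices of `X₂` = `γ`-stable self-dual lattices -/

section Bridge

variable {K : Type*} [Field K] [ValuativeRel K] {σ : K →+* K} {ϖ : K}

/-- **VERTICES ↔ LATTICES**: for `γ ∈ U(σ, H)`, the `γ`-fixed SELF-DUAL vertices of the lattice tree `X₂ = latticeTree σ ϖ H` are equinumerous with the `γ`-stable self-dual
lattices `S(H, γ) = {Λ = latt g : (σg)ᵀHg ∈ GL₂(𝒪), γΛ = Λ}` of ★ `SelfDualLatticeCountFrameTransport` (`x ↦ x.1`; ★ `isUnimodular₂_iff_exists_mem_glInt`, ★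
`latticeTreeIso_apply_eq_self_iff`). [cite: Serre1980Trees, II.1.1] [cite: Kottwitz1988, §2] -/
theorem ncard_fixed_selfDual_eq_ncard_selfDualStable (H : Matrix (Fin 2) (Fin 2) K) (γ : ↥(unitaryGroupOfForm σ H)) :
    {x : {M : Submodule 𝒪[K] (Fin 2 → K) // IsSpecialLattice σ ϖ H M} | IsSelfDualLattice σ H x.1 ∧ latticeTreeIso σ ϖ H γ x = x}.ncard =
      {Λ : Submodule 𝒪[K] (Fin 2 → K) |
        (∃ g : GL (Fin 2) K, (∃ J' ∈ glInt 2 K, (J' : Matrix (Fin 2) (Fin 2) K) = formCongr σ g H) ∧ Λ = Submodule.span 𝒪[K] (Set.range ((g : Matrix (Fin 2) (Fin 2) K))ᵀ)) ∧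
        Λ.map ((Matrix.toLin' (((γ : ↥(unitaryGroupOfForm σ H)) : GL (Fin 2) K) : Matrix (Fin 2) (Fin 2) K)).restrictScalars 𝒪[K]) = Λ}.ncard := by
  classical
  refine Set.ncard_congr (fun x _ => x.1) (fun x hx => ?_) (fun x y _ _ h => Subtype.ext h) (fun Λ hΛ => ?_)
  · -- a fixed self-dual vertex is a `γ`-stable self-dual lattice
    obtain ⟨hsd, hfix⟩ := hx
    obtain ⟨g, hM, hU⟩ := hsd
    rw [latticeTreeIso_apply_eq_self_iff] at hfix
    exact ⟨⟨g, (isUnimodular₂_iff_exists_mem_glInt _).1 hU, hM⟩, hfix⟩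
  · -- conversely
    obtain ⟨⟨g, hJ', hΛ⟩, hmap⟩ := hΛ
    have hsd : IsSelfDualLattice σ H Λ := ⟨g, hΛ, (isUnimodular₂_iff_exists_mem_glInt _).2 hJ'⟩
    refine ⟨⟨Λ, Or.inl hsd⟩, ⟨hsd, ?_⟩, rfl⟩
    rw [latticeTreeIso_apply_eq_self_iff]
    exact hmap

end Bridge

/-! ### §3 (HF2.2) `F₀(t_H) = Σ_{k ≤ N} q^k` for the type-(2) corner -/

section Count

variable {K : Type*} [Field K] [Valued K ℤᵐ⁰] [ValuativeRel K] [(Valued.v : Valuation K ℤᵐ⁰).Compatible] {σ : K →+* K} {ϖ : K}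

/-- **(HF2.2) THE FIXED SELF-DUAL VERTICES OF THE TYPE-(2) CORNER: `F₀(t_H) = Σ_{k ≤ N} q^k`.**  `K` non-dyadic (`hd : LocalConjDatum σ ϖ`), residual frame `(σO, a₀, #𝓀 = q²)` of ★
`ncard_selfDualStable_antidiag_companion_eq_sum` VERBATIM; `t_H ∈ U₂` with `↑t_H = (A Cρ; C A)`, `|ρ| = |ϖ|`, `|C| = |ϖ^N|` (the ★ B1∕B2 type-(2) letters).  Then the number of
`t_H`-fixed self-dual vertices of `X₂` — ★ H2-closed's `F₀`, set-builder VERBATIM — is `Σ_{k ∈ range (N+1)} q^k` (the self-dual half of the edge-centred ball of radius `N`):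
§2 ∘ ★ `exists_rescaled_cyclicFrame` (rescaled by `a = ϖ^{−⌊N∕2⌋}`, `e = N mod 2`) ∘ ★ `ncard_selfDualStable_congr` ∘ ★ `ncard_selfDualStable_antidiag_companion_eq_sum`.
[cite: Flicker1998UnitaryFL, §6 p. 97] [cite: Kottwitz1988, §2] [cite: Rogawski1990, §3.6 pp. 28–29] -/
theorem ncard_fixed_selfDual_eq_sum_of_typeTwoCorner (hd : HermitianLattice.LocalConjDatum σ ϖ)
    (σO : 𝒪[K] →+* 𝒪[K]) (hσO' : ∀ x : 𝒪[K], ((σO x : 𝒪[K]) : K) = σ x)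
    {a₀ : 𝒪[K]} (ha₀ : IsUnit (σO a₀ - a₀)) [Finite (IsLocalRing.ResidueField 𝒪[K])] {q : ℕ} (hq : Nat.card (IsLocalRing.ResidueField 𝒪[K]) = q ^ 2)
    {tH : ↥(unitaryGroupOfForm σ ((StdForm.antidiagonal 2).over K))} {A C ρ : K}
    (htH : ((tH : GL (Fin 2) K) : Matrix (Fin 2) (Fin 2) K) = !![A, C * ρ; C, A])
    (hvρ : Valued.v ρ = Valued.v ϖ) {N : ℕ} (hvC : Valued.v C = Valued.v (ϖ ^ N)) :
    {x : {M : Submodule 𝒪[K] (Fin 2 → K) // IsSpecialLattice σ ϖ ((StdForm.antidiagonal 2).over K) M} |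
        IsSelfDualLattice σ ((StdForm.antidiagonal 2).over K) x.1 ∧ latticeTreeIso σ ϖ ((StdForm.antidiagonal 2).over K) tH x = x}.ncard =
      ∑ k ∈ range (N + 1), q ^ k := by
  classical
  have hϖv := hd.vϖ
  have hϖ : IsUniformizingElement ϖ := isUniformizingElement_of_v_eq hϖv
  have h0 : ϖ ≠ 0 := hd.ϖ_ne_zero
  haveI : IsDiscreteValuationRing 𝒪[K] := isDiscreteValuationRing_integer_of_compatible hϖv
  have hvpow : ∀ j : ℕ, Valued.v (ϖ ^ j) = WithZero.exp (-(j : ℤ)) := fun j => by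
    rw [map_pow, hϖv, ← WithZero.exp_nsmul, nsmul_eq_mul, mul_neg, mul_one]
  have hv4 : Valued.v (4 : K) = 1 := by rw [show (4 : K) = 2 * 2 by norm_num, map_mul, hd.v2, one_mul]
  -- the datum in the `ValuativeRel` currency of the engine
  have hσv : ∀ x, valuation K (σ x) = valuation K x := fun x => (v_eq_iff_valuation_eq _ _).1 (hd.vσ x)
  have h2 : valuation K 2 = 1 := (v_eq_one_iff_valuation_eq_one _).1 hd.v2
  have hσσ : ∀ x, σO (σO x) = x := fun x => Subtype.ext (by rw [hσO', hσO', hd.σσ])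
  have hJ₂ : (StdForm.antidiagonal 2).over K = !![(0 : K), 1; 1, 0] := by
    ext i j; fin_cases i <;> fin_cases j <;> simp [StdForm.over, StdForm.antidiagonal_J_apply]
  -- the corner as a matrix, its unitarity, trace, determinant, `g₁₀ = C ≠ 0`
  set tGL : GL (Fin 2) K := (tH : GL (Fin 2) K) with htGL
  set g : Matrix (Fin 2) (Fin 2) K := !![A, C * ρ; C, A] with hg
  have hgU : (g.map σ)ᵀ * (!![0, 1; 1, 0] : Matrix (Fin 2) (Fin 2) K) * g = !![0, 1; 1, 0] := by
    have h := mem_unitaryGroupOfForm_iff.1 tH.2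
    rw [← htGL, htH] at h
    rwa [hJ₂] at h
  have htr_g : g.trace = 2 * A := by rw [hg, Matrix.trace_fin_two_of]; ring
  have hdet_g : g.det = A ^ 2 - C ^ 2 * ρ := by rw [hg, Matrix.det_fin_two_of]; ring
  have hg10 : g 1 0 = C := by simp [hg]
  have hC0 : C ≠ 0 := fun h => by rw [h, map_zero, hvpow] at hvC; exact WithZero.zero_ne_coe hvC
  have hg10' : g 1 0 ≠ 0 := by rw [hg10]; exact hC0
  -- the exponents: `N = 2r + e`, rescaling `a = ϖ^{−r}`
  obtain ⟨r, e, he, hNe⟩ : ∃ r e : ℕ, e ≤ 1 ∧ N = 2 * r + e := ⟨N / 2, N % 2, by omega, by omega⟩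
  set a : K := (ϖ ^ r)⁻¹ with ha
  have ha0 : a ≠ 0 := inv_ne_zero (pow_ne_zero _ h0)
  have hσa : σ a = a := by rw [ha, map_inv₀, map_pow, hd.σϖ]
  -- ★ the rescaled isotropic cyclic frame
  obtain ⟨P', hC', hform', hdβ, htr⟩ := exists_rescaled_cyclicFrame σ tGL g htH hgU hg10' ha0 hσa
  -- `|det| = 1`, `|A| ≤ 1`, `tr ∈ 𝒪`
  have hdv : valuation K g.det = 1 := by
    have h := congrArg (valuation K) hdβ
    rw [map_mul, Valuation.map_neg, hσv] at h
    exact mul_right_cancel₀ ((Valuation.ne_zero_iff _).2 hg10') (h.trans (one_mul _).symm)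
  have hvdet : Valued.v (A ^ 2 - C ^ 2 * ρ) = 1 := by rw [← hdet_g]; exact (v_eq_one_iff_valuation_eq_one _).2 hdv
  have hCρ : Valued.v (C ^ 2 * ρ) = Valued.v (ϖ ^ (2 * N + 1)) := by
    rw [map_mul, map_pow, hvC, hvρ, hvpow, hϖv, hvpow, ← WithZero.exp_nsmul, ← WithZero.exp_add]; congr 1; push_cast; ring
  have hvA : Valued.v A ≤ 1 := by
    have h1 : Valued.v (A ^ 2) ≤ max (Valued.v (A ^ 2 - C ^ 2 * ρ)) (Valued.v (C ^ 2 * ρ)) := by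
      have e1 : A ^ 2 = (A ^ 2 - C ^ 2 * ρ) + C ^ 2 * ρ := by ring
      rw [e1]; exact Valuation.map_add _ _ _ |>.trans (by rw [← e1])
    rw [map_pow, hvdet, hCρ, hvpow] at h1
    have h2' : Valued.v A ^ 2 ≤ 1 := h1.trans (max_le le_rfl (by rw [← WithZero.exp_zero, WithZero.exp_le_exp]; omega))
    exact (pow_le_one_iff two_ne_zero).1 h2'
  have ht : g.trace ∈ 𝒪[K] := (v_le_one_iff_mem_integer _).1 (by rw [htr_g, map_mul, hd.v2, one_mul]; exact hvA)
  -- `|tr² − 4det| = |4C²ρ| = |ϖ^{2N+1}|`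
  have hD : valuation K (g.trace ^ 2 - 4 * g.det) = valuation K (ϖ ^ (2 * N + 1)) := by
    refine (v_eq_iff_valuation_eq _ _).1 ?_
    rw [htr_g, hdet_g, show (2 * A) ^ 2 - 4 * (A ^ 2 - C ^ 2 * ρ) = 4 * (C ^ 2 * ρ) by ring, map_mul, hv4, one_mul, hCρ]
  -- `|a² g₁₀| = |ϖ^e|`
  have hβ' : valuation K (a ^ 2 * g 1 0) = valuation K (ϖ ^ e) := by
    refine (v_eq_iff_valuation_eq _ _).1 ?_
    rw [hg10, map_mul, map_pow, ha, map_inv₀, map_pow, hvC, map_pow, map_pow, hϖv]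
    simp only [← WithZero.exp_nsmul, ← WithZero.exp_neg, ← WithZero.exp_add, nsmul_eq_mul]
    congr 1; push_cast; omega
  have htr' : a ^ 2 * g 1 0 * σ g.trace + σ (a ^ 2 * g 1 0) * g.trace = 0 := by
    rw [map_mul, map_pow, hσa]; linear_combination a ^ 2 * htr
  have hform : formCongr σ P' ((StdForm.antidiagonal 2).over K) = !![0, a ^ 2 * g 1 0; σ (a ^ 2 * g 1 0), 0] := by rw [hJ₂]; exact hform'
  -- §2 bridge, ★ frame transport, ★ the type-(2) H-side lattice count
  rw [ncard_fixed_selfDual_eq_ncard_selfDualStable, ← htGL, ncard_selfDualStable_congr σ ((StdForm.antidiagonal 2).over K) tGL P', hform]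
  exact ncard_selfDualStable_antidiag_companion_eq_sum hϖ σ σO hσO' hσσ hd.σϖ hσv h2 ht hdv he hβ' hD htr' _ hC' ha₀ hq

end Count

end Summit.HodgeConjecture.HodgeConjecture.R90.S6

end
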